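import Literature.Geometry.Lorentzian.BogovskiiAnnulusOperator
import Literature.Geometry.Lorentzian.MomentChainSplitVec
import Literature.Geometry.Lorentzian.BogovskiiGluingVec
import Literature.Geometry.Lorentzian.BogovskiiVectorH1Bound
import HarnessLib

/-!
# A linear Bogovskiĭ-type operator `T` on the annulus `A₁` with `L² → H¹` bounds (Mao–Oh–Tao's Lemma 2.2 for `T`)

(trunk G08 = T-LORENTZ; family `gr`; namespace `Literature.Geometry.Lorentzian.MaoOhTao`.)

Mao–Oh–Tao (arXiv:2308.13031), Lemma 2.2 (p. 8), the operator `T` for the symmetric divergence `π ↦ ∂_i π^{ij}`,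
"the case of `T` being similar" (p. 9).  With the walk, cut-offs, bumps and kernel bumps of
`BogovskiiAnnulusOperator` and the Killing-moment bookkeeping `chainPieceK` of `MomentChainSplitVec`:

  `(T F)^{ij} = Σ_{k<16} T_{η̂_k}(F_k)^{ij}`, `F_k = chainPieceK annulusCutoff annulusBump 15 F k` (`annulusT`).

Proved: linearity on `C¹_c` (`annulusT_add_smul`), (T1) `supp (T F)^{ij} ⊆ Ā₁ = {1 ≤ r ≤ 2}`
(`norm_mem_Icc_of_annulusT_ne_zero`), `T F ∈ C¹` and symmetry, (T2) `Σ_i ∂_i (T F)^{ij} = F^j` pointwise for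
`F ∈ C²_c(A₁)` with vanishing Killing moments (`sum_pd_annulusT_eq`), and (T3) at the `L²` level:
`∫ |(T F)^{ij}|², ∫ |∂_l (T F)^{ij}|² ≤ C Σ_k ∫ |F_k|²` (`exists_sobolevConst_annulusT`, from `exists_l2Const_bogovskiiT`
and the gain-one bound `exists_h1Const_bogovskiiT`).

## References

* Y. Mao, S.-J. Oh, T. Tao, arXiv:2308.13031 (2023), Lemma 2.2 and its proof, pp. 8–9 (key `MaoOhTao2023`).
-/

noncomputable section

open scoped RealInnerProductSpace Topology ENNReal
open Filter MeasureTheory Set Metric Function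

namespace Literature.Geometry.Lorentzian

namespace MaoOhTao

/-- **The linear Bogovskiĭ-type operator `T` on the annulus**. [cite: MaoOhTao2023, Lemma 2.2] -/
def annulusT (F : Fin 3 → E3 → ℝ) (i j : Fin 3) (x : E3) : ℝ :=
  ∑ k ∈ Finset.range (15 + 1),
    bogovskiiT (kernelBump k) (fun l ↦ chainPieceK annulusCutoff annulusBump 15 F k l) i j x

/-! ### The vector pieces of a density supported in the annulus -/

section Pieces

variable {F G : Fin 3 → E3 → ℝ}

/-- `Σ_{k<16} φ_k = 1` wherever a component of `F` is nonzero (`tsupp F_j ⊆ A₁`). [folklore] -/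
theorem sum_annulusCutoff_eq_one_of_ne_zero_vec (hFA : ∀ j, tsupport (F j) ⊆ {x : E3 | 1 < ‖x‖ ∧ ‖x‖ < 2})
    (j : Fin 3) (x : E3) (hx : F j x ≠ 0) : ∑ k ∈ Finset.range (15 + 1), annulusCutoff k x = 1 :=
  sum_annulusCutoff_eq_one_of_ne_zero (hFA j) x hx

/-- **The `k`-th vector piece vanishes off the `k`-th sector** (`k ≤ 15`). [cite: MaoOhTao2023, Lemma 2.2 (proof)] -/
theorem annulusPieceK_eq_zero (hFA : ∀ j, tsupport (F j) ⊆ {x : E3 | 1 < ‖x‖ ∧ ‖x‖ < 2}) {k : ℕ} (hk : k ≤ 15)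
    (j : Fin 3) {y : E3} (hy : y ∉ annSector (walkDir k)) : chainPieceK annulusCutoff annulusBump 15 F k j y = 0 := by
  refine chainPieceK_eq_zero_of_notMem annulusCutoff annulusBump 15 F k (V := annSector (walkDir k)) ?_ ?_ ?_ j hy
  · intro j x hx
    by_contra h
    rcases mul_ne_zero_iff.1 h with ⟨hf, hφ⟩
    have hA := mem_annulus_of_mem_tsupport (hFA j) hf
    have hC : x ∈ dirCone (walkDir k) := tsupport_annulusCutoff_subset k (subset_tsupport _ (mem_support.2 hφ))
    exact hx (by rw [annSector_eq_inter]; exact ⟨hA, hC⟩)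
  · intro hk1 x hx
    refine annulusBump_eq_zero (by omega) hk1 fun h ↦ hx ?_
    have : k + 1 - 1 = k := by omega
    rw [this] at h
    exact h.2
  · intro hk1 x hx
    exact annulusBump_eq_zero hk1 hk fun h ↦ hx h.1

/-- The vector pieces are supported in their sectors. [cite: MaoOhTao2023, Lemma 2.2 (proof)] -/
theorem mem_annSector_of_annulusPieceK_ne_zero (hFA : ∀ j, tsupport (F j) ⊆ {x : E3 | 1 < ‖x‖ ∧ ‖x‖ < 2}) {k : ℕ}
    (hk : k ≤ 15) {j : Fin 3} {y : E3} (hy : chainPieceK annulusCutoff annulusBump 15 F k j y ≠ 0) :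
    y ∈ annSector (walkDir k) := by
  by_contra h
  exact hy (annulusPieceK_eq_zero hFA hk j h)

/-- `(F_k)_j(y) ≠ 0 ⟹ |y| ≤ 2`. [folklore] -/
theorem norm_le_two_of_annulusPieceK_ne_zero (hFA : ∀ j, tsupport (F j) ⊆ {x : E3 | 1 < ‖x‖ ∧ ‖x‖ < 2}) {k : ℕ}
    (hk : k ≤ 15) (j : Fin 3) (y : E3) (hy : chainPieceK annulusCutoff annulusBump 15 F k j y ≠ 0) : ‖y‖ ≤ 2 :=
  ((mem_annSector_of_annulusPieceK_ne_zero hFA hk hy).2.1).le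

/-- Continuity of the vector pieces. [folklore] -/
theorem continuous_annulusPieceK (hF : ∀ j, Continuous (F j)) (k : ℕ) (j : Fin 3) :
    Continuous (chainPieceK annulusCutoff annulusBump 15 F k j) :=
  continuous_chainPieceK continuous_annulusCutoff continuous_annulusBump 15 hF k j

/-- `Cⁿ` regularity of the vector pieces (`n = 1, 2`). [folklore] -/
theorem contDiff_annulusPieceK {n : ℕ} (hF : ∀ j, ContDiff ℝ n (F j)) (k : ℕ) (j : Fin 3) :
    ContDiff ℝ n (chainPieceK annulusCutoff annulusBump 15 F k j) :=
  contDiff_chainPieceK (n := n) (fun i ↦ contDiff_annulusCutoff (n := n) i)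
    (fun i ↦ contDiff_annulusBump (n := n) i) 15 hF k j

/-- Compact support of the vector pieces. [folklore] -/
theorem hasCompactSupport_annulusPieceK (hFc : ∀ j, HasCompactSupport (F j)) (k : ℕ) (j : Fin 3) :
    HasCompactSupport (chainPieceK annulusCutoff annulusBump 15 F k j) :=
  hasCompactSupport_chainPieceK annulusCutoff hasCompactSupport_annulusBump 15 hFc k j

/-- **The vector pieces of a Killing-moment-free density are Killing-moment-free** (`k ≤ 15`).
[cite: MaoOhTao2023, Lemma 2.2 (proof)] -/
theorem integral_annulusPieceK_killingFn (hF : ∀ j, Continuous (F j)) (hFc : ∀ j, HasCompactSupport (F j))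
    (hFA : ∀ j, tsupport (F j) ⊆ {x : E3 | 1 < ‖x‖ ∧ ‖x‖ < 2})
    (hmom : ∀ a, ∫ y : E3, ∑ j, F j y * killingFn a y j = 0) {k : ℕ} (hk : k ≤ 15) (a : Fin 3 ⊕ Fin 3) :
    ∫ x : E3, ∑ j, chainPieceK annulusCutoff annulusBump 15 F k j x * killingFn a x j = 0 :=
  integral_chainPieceK_killingFn_eq_zero_of_moments continuous_annulusCutoff continuous_annulusBump
    hasCompactSupport_annulusBump (p := walkPt) (fun i _ _ ↦ annulusBump_walkPt i) hF hFc
    (sum_annulusCutoff_eq_one_of_ne_zero_vec hFA) hmom hk a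

/-- **The vector pieces sum to `F`**. [cite: MaoOhTao2023, Lemma 2.2 (proof)] -/
theorem sum_annulusPieceK_eq (hFA : ∀ j, tsupport (F j) ⊆ {x : E3 | 1 < ‖x‖ ∧ ‖x‖ < 2}) (j : Fin 3) (x : E3) :
    ∑ k ∈ Finset.range (15 + 1), chainPieceK annulusCutoff annulusBump 15 F k j x = F j x :=
  sum_chainPieceK_eq_self annulusCutoff annulusBump 15 F (sum_annulusCutoff_eq_one_of_ne_zero_vec hFA) j x

end Pieces

/-! ### Linearity of `SV_η` and `T_η` in the density -/

section Linear

variable {η : E3 → ℝ} {R : ℝ}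

/-- **`SV_η` is linear** on continuous compactly supported densities. [folklore] -/
theorem bogovskiiSV_add_smul (hη : Continuous η) (hR : ∀ z : E3, R < ‖z‖ → η z = 0) {u v : E3 → ℝ}
    (hu : Continuous u) (huc : HasCompactSupport u) (hv : Continuous v) (hvc : HasCompactSupport v) (a b : ℝ)
    (c : Fin 3) (x : E3) :
    bogovskiiSV η (fun y ↦ a * u y + b * v y) c x = a * bogovskiiSV η u c x + b * bogovskiiSV η v c x := by
  simp only [bogovskiiSV_apply, bogovskiiVOperator_eq_translated]
  have Iu := integrable_vtranslated hη hR hu huc x c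
  have Iv := integrable_vtranslated hη hR hv hvc x c
  rw [← integral_const_mul, ← integral_const_mul, ← integral_add (Iu.const_mul a) (Iv.const_mul b)]
  refine integral_congr_ae (ae_of_all _ fun z ↦ ?_)
  simp only
  ring

/-- `∂_m S_η` is linear on `C¹_c` densities (`η ∈ C¹`). [folklore] -/
theorem pd_bogovskiiS_add_smul (hη : ContDiff ℝ 1 η) (hR : ∀ z : E3, R < ‖z‖ → η z = 0) {u v : E3 → ℝ}
    (hu : ContDiff ℝ 1 u) (huc : HasCompactSupport u) (hv : ContDiff ℝ 1 v) (hvc : HasCompactSupport v) (a b : ℝ)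
    (i j m : Fin 3) (x : E3) :
    pd m (bogovskiiS η (fun y ↦ a * u y + b * v y) i j) x =
      a * pd m (bogovskiiS η u i j) x + b * pd m (bogovskiiS η v i j) x := by
  have hfun : bogovskiiS η (fun y ↦ a * u y + b * v y) i j =
      fun x ↦ a * bogovskiiS η u i j x + b * bogovskiiS η v i j x :=
    funext fun x ↦ bogovskiiS_add_smul hη.continuous hR hu.continuous huc hv.continuous hvc a b i j x
  have du : DifferentiableAt ℝ (bogovskiiS η u i j) x :=
    ((contDiff_one_bogovskiiS hη hR hu huc i j).differentiable one_ne_zero) x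
  have dv : DifferentiableAt ℝ (bogovskiiS η v i j) x :=
    ((contDiff_one_bogovskiiS hη hR hv hvc i j).differentiable one_ne_zero) x
  rw [hfun, pd_add (du.const_mul a) (dv.const_mul b), pd_const_mul' a du, pd_const_mul' b dv]

/-- **`T_η` is linear** on `C¹_c` vector densities (`η ∈ C¹`). [folklore] -/
theorem bogovskiiT_add_smul (hη : ContDiff ℝ 1 η) (hR : ∀ z : E3, R < ‖z‖ → η z = 0) {U V : Fin 3 → E3 → ℝ}
    (hU : ∀ k, ContDiff ℝ 1 (U k)) (hUc : ∀ k, HasCompactSupport (U k)) (hV : ∀ k, ContDiff ℝ 1 (V k))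
    (hVc : ∀ k, HasCompactSupport (V k)) (a b : ℝ) (i j : Fin 3) (x : E3) :
    bogovskiiT η (fun k y ↦ a * U k y + b * V k y) i j x = a * bogovskiiT η U i j x + b * bogovskiiT η V i j x := by
  simp only [bogovskiiT]
  have hSV : ∀ k c, bogovskiiSV η (fun y ↦ a * U k y + b * V k y) c x =
      a * bogovskiiSV η (U k) c x + b * bogovskiiSV η (V k) c x := fun k c ↦
    bogovskiiSV_add_smul hη.continuous hR (hU k).continuous (hUc k) (hV k).continuous (hVc k) a b c x
  have hSK : ∀ k c d m, pd m (bogovskiiS η (fun y ↦ a * U k y + b * V k y) c d) x =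
      a * pd m (bogovskiiS η (U k) c d) x + b * pd m (bogovskiiS η (V k) c d) x := fun k c d m ↦
    pd_bogovskiiS_add_smul hη hR (hU k) (hUc k) (hV k) (hVc k) a b c d m x
  simp only [hSV, hSK, Finset.sum_add_distrib, ← Finset.mul_sum]
  ring

end Linear

/-! ### (T1), (T2), regularity, symmetry and linearity of the annulus operator `T` -/

section Properties

variable {F G : Fin 3 → E3 → ℝ}

/-- Each term of `annulusT` is supported in the closure of its sector. [cite: MaoOhTao2023, Lemma 2.2 (T1)] -/
theorem support_termT_subset (hFA : ∀ j, tsupport (F j) ⊆ {x : E3 | 1 < ‖x‖ ∧ ‖x‖ < 2}) {k : ℕ} (hk : k ≤ 15)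
    (i j : Fin 3) :
    support (bogovskiiT (kernelBump k) (fun l ↦ chainPieceK annulusCutoff annulusBump 15 F k l) i j) ⊆
      closure (annSector (walkDir k)) :=
  support_bogovskiiT_subset (starConvex_of_kernelBump k) (fun _ hz ↦ mem_ball_of_kernelBump_ne_zero k hz)
    (fun _ _ hy ↦ mem_annSector_of_annulusPieceK_ne_zero hFA hk hy) i j

/-- The closure of a sector lies in the closed shell `{1 ≤ r ≤ 2}`. [folklore] -/
theorem closure_annSector_subset (w : E3) : closure (annSector w) ⊆ {x : E3 | 1 ≤ ‖x‖ ∧ ‖x‖ ≤ 2} := by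
  refine closure_minimal (fun x hx ↦ ⟨hx.1.le, hx.2.1.le⟩) ?_
  exact (isClosed_le continuous_const continuous_norm).inter (isClosed_le continuous_norm continuous_const)

/-- **(T1)**: `supp (T F)^{ij} ⊆ Ā₁ = {1 ≤ r ≤ 2}` for `tsupp F ⊆ A₁`. [cite: MaoOhTao2023, Lemma 2.2 (T1)] -/
theorem norm_mem_of_annulusT_ne_zero (hFA : ∀ j, tsupport (F j) ⊆ {x : E3 | 1 < ‖x‖ ∧ ‖x‖ < 2}) (i j : Fin 3)
    {x : E3} (hx : annulusT F i j x ≠ 0) : 1 ≤ ‖x‖ ∧ ‖x‖ ≤ 2 := by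
  rw [annulusT] at hx
  obtain ⟨k, hk, hne⟩ := Finset.exists_ne_zero_of_sum_ne_zero hx
  rw [Finset.mem_range] at hk
  exact closure_annSector_subset _ (support_termT_subset hFA (by omega) i j (mem_support.2 hne))

/-- **`T F ∈ C¹`** for `F ∈ C²_c`. [cite: MaoOhTao2023, Lemma 2.2] -/
theorem contDiff_one_annulusT (hF : ∀ j, ContDiff ℝ 2 (F j)) (hFc : ∀ j, HasCompactSupport (F j)) (i j : Fin 3) :
    ContDiff ℝ 1 (annulusT F i j) := by
  have h : annulusT F i j = fun x ↦ ∑ k ∈ Finset.range (15 + 1),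
      bogovskiiT (kernelBump k) (fun l ↦ chainPieceK annulusCutoff annulusBump 15 F k l) i j x := rfl
  rw [h]
  exact ContDiff.sum fun k _ ↦ contDiff_one_bogovskiiT (contDiff_kernelBump (n := 2) k) (kernelBump_eq_zero_of_lt k)
    (fun l ↦ contDiff_annulusPieceK hF k l) (fun l ↦ hasCompactSupport_annulusPieceK hFc k l) i j

/-- **`T F` is symmetric.** [cite: MaoOhTao2023, Lemma 2.2] -/
theorem annulusT_symm (F : Fin 3 → E3 → ℝ) (i j : Fin 3) (x : E3) : annulusT F i j x = annulusT F j i x := by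
  simp only [annulusT]
  exact Finset.sum_congr rfl fun k _ ↦ bogovskiiT_symm _ _ i j x

/-- **(T2)**: `Σ_i ∂_i (T F)^{ij} = F^j` pointwise, for `F ∈ C²_c` with `tsupp F ⊆ A₁` and vanishing Killing moments
`∫ F · (e₁, e₂, e₃, Y₁, Y₂, Y₃) dx = 0`. [cite: MaoOhTao2023, Lemma 2.2 (T2)] -/
theorem sum_pd_annulusT_eq (hF : ∀ j, ContDiff ℝ 2 (F j)) (hFc : ∀ j, HasCompactSupport (F j))
    (hFA : ∀ j, tsupport (F j) ⊆ {x : E3 | 1 < ‖x‖ ∧ ‖x‖ < 2})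
    (hmom : ∀ a, ∫ y : E3, ∑ j, F j y * killingFn a y j = 0) (j : Fin 3) (x : E3) :
    ∑ i, pd i (annulusT F i j) x = F j x := by
  set P : ℕ → Fin 3 → E3 → ℝ := fun k l ↦ chainPieceK annulusCutoff annulusBump 15 F k l with hP
  have hP2 : ∀ k l, ContDiff ℝ 2 (P k l) := fun k l ↦ contDiff_annulusPieceK hF k l
  have hPc : ∀ k l, HasCompactSupport (P k l) := fun k l ↦ hasCompactSupport_annulusPieceK hFc k l
  set T : ℕ → Fin 3 → Fin 3 → E3 → ℝ := fun k i j ↦ bogovskiiT (kernelBump k) (P k) i j with hT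
  have hT1 : ∀ k i j, ContDiff ℝ 1 (T k i j) := fun k i j ↦ contDiff_one_bogovskiiT (contDiff_kernelBump (n := 2) k)
    (kernelBump_eq_zero_of_lt k) (hP2 k) (hPc k) i j
  have h1 : ∀ i, pd i (annulusT F i j) x = ∑ k ∈ Finset.range (15 + 1), pd i (T k i j) x := by
    intro i
    have h : annulusT F i j = fun x ↦ ∑ k ∈ Finset.range (15 + 1), T k i j x := rfl
    rw [h]
    exact pd_sum _ _ fun k _ ↦ ((hT1 k i j).differentiable one_ne_zero) x
  simp only [h1]
  rw [Finset.sum_comm]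
  rw [show ∑ k ∈ Finset.range (15 + 1), ∑ i, pd i (T k i j) x = ∑ k ∈ Finset.range (15 + 1), P k j x from
    Finset.sum_congr rfl fun k hk ↦ ?_]
  · exact sum_annulusPieceK_eq hFA j x
  · rw [Finset.mem_range] at hk
    have hk' : k ≤ 15 := by omega
    have hKm : ∀ a, ∫ y : E3, ∑ l, P k l y * killingFn a y l = 0 := fun a ↦
      integral_annulusPieceK_killingFn (fun l ↦ (hF l).continuous) hFc hFA hmom hk' a
    exact sum_pd_bogovskiiT_eq (contDiff_kernelBump (n := 2) k) (kernelBump_eq_zero_of_lt k) (hP2 k) (hPc k)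
      (integral_kernelBump k) (killing_moments_translation hKm)
      (killing_moments_rotation (fun l ↦ (hP2 k l).continuous) (hPc k) hKm) j x

/-- **Linearity**: `T(a F + b G) = a T F + b T G` for `F, G ∈ C¹_c`. [cite: MaoOhTao2023, Lemma 2.2] -/
theorem annulusT_add_smul (hF : ∀ j, ContDiff ℝ 1 (F j)) (hFc : ∀ j, HasCompactSupport (F j))
    (hG : ∀ j, ContDiff ℝ 1 (G j)) (hGc : ∀ j, HasCompactSupport (G j)) (a b : ℝ) (i j : Fin 3) (x : E3) :
    annulusT (fun l y ↦ a * F l y + b * G l y) i j x = a * annulusT F i j x + b * annulusT G i j x := by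
  simp only [annulusT, Finset.mul_sum, ← Finset.sum_add_distrib]
  refine Finset.sum_congr rfl fun k _ ↦ ?_
  have hp : (fun l ↦ chainPieceK annulusCutoff annulusBump 15 (fun l y ↦ a * F l y + b * G l y) k l) =
      fun l y ↦ a * chainPieceK annulusCutoff annulusBump 15 F k l y +
        b * chainPieceK annulusCutoff annulusBump 15 G k l y :=
    funext fun l ↦ funext fun y ↦ chainPieceK_add_smul continuous_annulusCutoff annulusBump 15
      (fun l ↦ (hF l).continuous) hFc (fun l ↦ (hG l).continuous) hGc a b k l y
  rw [hp]
  exact bogovskiiT_add_smul (contDiff_kernelBump (n := 1) k) (kernelBump_eq_zero_of_lt k)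
    (fun l ↦ contDiff_annulusPieceK hF k l) (fun l ↦ hasCompactSupport_annulusPieceK hFc k l)
    (fun l ↦ contDiff_annulusPieceK hG k l) (fun l ↦ hasCompactSupport_annulusPieceK hGc k l) a b i j x

end Properties


/-! ### `L²` bounds for the vector pieces -/

section PieceBoundsVec

variable {F : Fin 3 → E3 → ℝ}

/-- **Cauchy–Schwarz for weighted localised integrals**: for `|φ| ≤ 1`, `f` continuous vanishing off `B̄_ρ` and a
continuous weight `w`, `‖∫ f φ w‖² ≤ (∫_{B̄_ρ} |w|²) ∫ |f|²`. [folklore] -/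
theorem enorm_weighted_sq_le {f φ w : E3 → ℝ} (hf : Continuous f) (hφ1 : ∀ x, |φ x| ≤ 1) (hw : Continuous w)
    {ρ : ℝ} (hfρ : ∀ y, f y ≠ 0 → ‖y‖ ≤ ρ) :
    ‖∫ y : E3, f y * φ y * w y‖ₑ ^ (2 : ℝ) ≤
      (∫⁻ y in closedBall (0 : E3) ρ, ‖w y‖ₑ ^ (2 : ℝ)) * ∫⁻ y : E3, ‖f y‖ₑ ^ (2 : ℝ) := by
  set K : E3 → ℝ≥0∞ := (closedBall (0 : E3) ρ).indicator fun y ↦ ‖w y‖ₑ with hK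
  have hKm : Measurable K := hw.measurable.enorm.indicator measurableSet_closedBall
  have hFm : Measurable fun y : E3 ↦ ‖f y‖ₑ := hf.measurable.enorm
  have hpt : ∀ y, ‖f y * φ y * w y‖ₑ ≤ ‖f y‖ₑ * K y := by
    intro y
    by_cases hy : f y = 0
    · simp [hy]
    · have hmem : y ∈ closedBall (0 : E3) ρ := by rw [mem_closedBall, dist_zero_right]; exact hfρ y hy
      rw [hK, indicator_of_mem hmem, enorm_mul, enorm_mul]
      have h1 : ‖φ y‖ₑ ≤ 1 := by
        rw [Real.enorm_eq_ofReal_abs]; exact ENNReal.ofReal_le_one.2 (hφ1 y)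
      calc ‖f y‖ₑ * ‖φ y‖ₑ * ‖w y‖ₑ ≤ ‖f y‖ₑ * 1 * ‖w y‖ₑ := by gcongr
        _ = _ := by rw [mul_one]
  have h1 : ‖∫ y : E3, f y * φ y * w y‖ₑ ≤ ∫⁻ y, ‖f y‖ₑ * K y :=
    (enorm_integral_le_lintegral_enorm _).trans (lintegral_mono hpt)
  have hCS := ENNReal.lintegral_mul_le_Lp_mul_Lq volume Real.HolderConjugate.two_two hFm.aemeasurable hKm.aemeasurable
  have hK2 : ∫⁻ y, K y ^ (2 : ℝ) = ∫⁻ y in closedBall (0 : E3) ρ, ‖w y‖ₑ ^ (2 : ℝ) := by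
    rw [← lintegral_indicator measurableSet_closedBall]
    refine lintegral_congr fun y ↦ ?_
    by_cases hy : y ∈ closedBall (0 : E3) ρ
    · rw [hK, indicator_of_mem hy, indicator_of_mem hy]
    · rw [hK, indicator_of_notMem hy, indicator_of_notMem hy, ENNReal.zero_rpow_of_pos (by norm_num)]
  calc ‖∫ y : E3, f y * φ y * w y‖ₑ ^ (2 : ℝ) ≤ (∫⁻ y, ‖f y‖ₑ * K y) ^ (2 : ℝ) :=
        ENNReal.rpow_le_rpow h1 (by norm_num)
    _ ≤ ((∫⁻ y, ‖f y‖ₑ ^ (2 : ℝ)) ^ (1 / (2 : ℝ)) * (∫⁻ y, K y ^ (2 : ℝ)) ^ (1 / (2 : ℝ))) ^ (2 : ℝ) :=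
        ENNReal.rpow_le_rpow hCS (by norm_num)
    _ = (∫⁻ y, ‖f y‖ₑ ^ (2 : ℝ)) * ∫⁻ y, K y ^ (2 : ℝ) := by
        rw [ENNReal.mul_rpow_of_nonneg _ _ (by norm_num), ← ENNReal.rpow_mul, ← ENNReal.rpow_mul]
        norm_num
    _ = _ := by rw [hK2, mul_comm]

/-- The Killing weights `∫_{B̄_ρ} |(K_a)_i|²` are finite. [folklore] -/
theorem lintegral_killingFn_sq_lt_top (ρ : ℝ) (a : Fin 3 ⊕ Fin 3) (i : Fin 3) :
    ∫⁻ y in closedBall (0 : E3) ρ, ‖killingFn a y i‖ₑ ^ (2 : ℝ) < ⊤ := by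
  obtain ⟨C, hC⟩ := (isCompact_closedBall (0 : E3) ρ).exists_bound_of_continuousOn
    (f := fun y : E3 ↦ killingFn a y i) (continuous_killingFn a i).continuousOn
  refine (setLIntegral_lt_top_of_le_nnreal measure_closedBall_lt_top.ne ⟨⟨C ^ 2, by positivity⟩, fun y hy ↦ ?_⟩)
  have h := hC y hy
  have hC0 : 0 ≤ C := (norm_nonneg _).trans h
  rw [← enorm_norm, Real.enorm_eq_ofReal (norm_nonneg _), ENNReal.ofReal_rpow_of_nonneg (norm_nonneg _) (by norm_num),
    ENNReal.ofReal_le_iff_le_toReal ENNReal.coe_ne_top]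
  · simp only [ENNReal.coe_toReal, Real.rpow_two]
    exact pow_le_pow_left₀ (norm_nonneg _) h 2

/-- **Bound for the localised Killing moments**: with `PK = Σ_a Σ_i ∫_{B̄₂} |(K_a)_i|²` and `SG = Σ_j ∫ |F_j|²`,
`‖∫ (F φ) · K_a‖² ≤ 9 PK SG` (`|φ| ≤ 1`, `tsupp F ⊆ A₁`). [folklore] -/
theorem enorm_killingMoment_sq_le (hF : ∀ j, Continuous (F j)) (hFc : ∀ j, HasCompactSupport (F j))
    (hFA : ∀ j, tsupport (F j) ⊆ {x : E3 | 1 < ‖x‖ ∧ ‖x‖ < 2}) {φ : E3 → ℝ} (hφ : Continuous φ)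
    (hφ1 : ∀ x, |φ x| ≤ 1) (a : Fin 3 ⊕ Fin 3) :
    ‖∫ y : E3, ∑ i, F i y * φ y * killingFn a y i‖ₑ ^ (2 : ℝ) ≤
      9 * ((∑ a' : Fin 3 ⊕ Fin 3, ∑ i, ∫⁻ y in closedBall (0 : E3) 2, ‖killingFn a' y i‖ₑ ^ (2 : ℝ)) *
        ∑ j, ∫⁻ y : E3, ‖F j y‖ₑ ^ (2 : ℝ)) := by
  set PK : ℝ≥0∞ := ∑ a' : Fin 3 ⊕ Fin 3, ∑ i, ∫⁻ y in closedBall (0 : E3) 2, ‖killingFn a' y i‖ₑ ^ (2 : ℝ) with hPK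
  set SG : ℝ≥0∞ := ∑ j, ∫⁻ y : E3, ‖F j y‖ₑ ^ (2 : ℝ) with hSG
  have hFρ : ∀ i y, F i y ≠ 0 → ‖y‖ ≤ 2 := fun i y hy ↦ (mem_annulus_of_mem_tsupport (hFA i) hy).2.le
  have hI : ∀ i, Integrable fun y : E3 ↦ F i y * φ y * killingFn a y i := fun i ↦
    (((hF i).mul hφ).mul (continuous_killingFn a i)).integrable_of_hasCompactSupport (hFc i).mul_right.mul_right
  have hPle : ∀ i, (∫⁻ y in closedBall (0 : E3) 2, ‖killingFn a y i‖ₑ ^ (2 : ℝ)) ≤ PK := fun i ↦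
    (Finset.single_le_sum (f := fun i ↦ ∫⁻ y in closedBall (0 : E3) 2, ‖killingFn a y i‖ₑ ^ (2 : ℝ))
      (fun _ _ ↦ by positivity) (Finset.mem_univ i)).trans
      (Finset.single_le_sum (f := fun a' : Fin 3 ⊕ Fin 3 ↦ ∑ i, ∫⁻ y in closedBall (0 : E3) 2,
        ‖killingFn a' y i‖ₑ ^ (2 : ℝ)) (fun _ _ ↦ by positivity) (Finset.mem_univ a))
  have hGle : ∀ i, (∫⁻ y : E3, ‖F i y‖ₑ ^ (2 : ℝ)) ≤ SG := fun i ↦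
    Finset.single_le_sum (f := fun j ↦ ∫⁻ y : E3, ‖F j y‖ₑ ^ (2 : ℝ)) (fun _ _ ↦ by positivity) (Finset.mem_univ i)
  have hm : ∀ i, ‖∫ y : E3, F i y * φ y * killingFn a y i‖ₑ ^ (2 : ℝ) ≤ PK * SG := fun i ↦
    (enorm_weighted_sq_le (hF i) hφ1 (continuous_killingFn a i) (hFρ i)).trans (mul_le_mul' (hPle i) (hGle i))
  rw [integral_finsetSum _ fun i _ ↦ hI i]
  calc ‖∑ i, ∫ y : E3, F i y * φ y * killingFn a y i‖ₑ ^ (2 : ℝ)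
      ≤ (∑ i, ‖∫ y : E3, F i y * φ y * killingFn a y i‖ₑ) ^ (2 : ℝ) :=
        ENNReal.rpow_le_rpow (enorm_sum_le _ _) (by norm_num)
    _ ≤ 3 * ∑ i, ‖∫ y : E3, F i y * φ y * killingFn a y i‖ₑ ^ (2 : ℝ) := enorm_sum_three_sq_le _
    _ ≤ 3 * ∑ _i : Fin 3, PK * SG := by gcongr with i; exact hm i
    _ = 9 * (PK * SG) := by
        rw [Finset.sum_const, Finset.card_univ, Fintype.card_fin, nsmul_eq_mul]; push_cast; ring

/-- **Bound for the tail Killing moments**: `‖M_k^a‖² ≤ 16 · 16 · 9 PK SG`. [folklore] -/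
theorem enorm_chainMomentK_sq_le (hF : ∀ j, Continuous (F j)) (hFc : ∀ j, HasCompactSupport (F j))
    (hFA : ∀ j, tsupport (F j) ⊆ {x : E3 | 1 < ‖x‖ ∧ ‖x‖ < 2}) (k : ℕ) (a : Fin 3 ⊕ Fin 3) :
    ‖chainMomentK annulusCutoff 15 F k a‖ₑ ^ (2 : ℝ) ≤
      16 * (16 * (9 * ((∑ a' : Fin 3 ⊕ Fin 3, ∑ i, ∫⁻ y in closedBall (0 : E3) 2, ‖killingFn a' y i‖ₑ ^ (2 : ℝ)) *
        ∑ j, ∫⁻ y : E3, ‖F j y‖ₑ ^ (2 : ℝ)))) := by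
  set P : ℝ≥0∞ := 9 * ((∑ a' : Fin 3 ⊕ Fin 3, ∑ i, ∫⁻ y in closedBall (0 : E3) 2, ‖killingFn a' y i‖ₑ ^ (2 : ℝ)) *
    ∑ j, ∫⁻ y : E3, ‖F j y‖ₑ ^ (2 : ℝ)) with hP
  have hm : ∀ i, ‖∫ y : E3, ∑ l, F l y * annulusCutoff i y * killingFn a y l‖ₑ ^ (2 : ℝ) ≤ P := fun i ↦
    enorm_killingMoment_sq_le hF hFc hFA (continuous_annulusCutoff i) (abs_annulusCutoff_le i) a
  have hsub : Finset.Icc k 15 ⊆ Finset.range 16 := fun i hi ↦ by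
    rw [Finset.mem_Icc] at hi; rw [Finset.mem_range]; omega
  calc ‖chainMomentK annulusCutoff 15 F k a‖ₑ ^ (2 : ℝ)
      ≤ (∑ i ∈ Finset.Icc k 15, ‖∫ y : E3, ∑ l, F l y * annulusCutoff i y * killingFn a y l‖ₑ) ^ (2 : ℝ) := by
        rw [chainMomentK]
        exact ENNReal.rpow_le_rpow (enorm_sum_le _ _) (by norm_num)
    _ ≤ (∑ i ∈ Finset.range 16, ‖∫ y : E3, ∑ l, F l y * annulusCutoff i y * killingFn a y l‖ₑ) ^ (2 : ℝ) :=
        ENNReal.rpow_le_rpow (Finset.sum_le_sum_of_subset hsub) (by norm_num)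
    _ ≤ (Finset.range 16).card * ∑ i ∈ Finset.range 16,
          ‖∫ y : E3, ∑ l, F l y * annulusCutoff i y * killingFn a y l‖ₑ ^ (2 : ℝ) := enorm_finset_sum_sq_le _ _
    _ ≤ (16 : ℕ) * ∑ _i ∈ Finset.range 16, P := by
        rw [Finset.card_range]
        gcongr with i
        exact hm i
    _ = 16 * (16 * P) := by
        rw [Finset.sum_const, Finset.card_range, nsmul_eq_mul]; push_cast; ring

/-- **`L²` bound of a vector correction sum**: `∫ |Σ_a c_a (θ^a[ζ])_j|² ≤ 6 Σ_a ‖c_a‖² ∫ |(θ^a[ζ])_j|²`. [folklore] -/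
theorem lintegral_sum_mul_thetaK_sq_le {ζ : E3 → ℝ} (hζ : Continuous ζ) (c : Fin 3 ⊕ Fin 3 → ℝ) (j : Fin 3) :
    ∫⁻ x : E3, ‖∑ a, c a * thetaK ζ a x j‖ₑ ^ (2 : ℝ) ≤
      6 * ∑ a, ‖c a‖ₑ ^ (2 : ℝ) * ∫⁻ x : E3, ‖thetaK ζ a x j‖ₑ ^ (2 : ℝ) := by
  have hmeas : ∀ a, Measurable fun x : E3 ↦ ‖c a‖ₑ ^ (2 : ℝ) * ‖thetaK ζ a x j‖ₑ ^ (2 : ℝ) := fun a ↦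
    ((continuous_thetaK hζ a j).measurable.enorm.pow_const _).const_mul _
  have hpt : ∀ x, ‖∑ a, c a * thetaK ζ a x j‖ₑ ^ (2 : ℝ) ≤ 6 * ∑ a, ‖c a‖ₑ ^ (2 : ℝ) * ‖thetaK ζ a x j‖ₑ ^ (2 : ℝ) := by
    intro x
    calc ‖∑ a, c a * thetaK ζ a x j‖ₑ ^ (2 : ℝ) ≤ (∑ a, ‖c a * thetaK ζ a x j‖ₑ) ^ (2 : ℝ) :=
          ENNReal.rpow_le_rpow (enorm_sum_le _ _) (by norm_num)
      _ ≤ (Finset.univ : Finset (Fin 3 ⊕ Fin 3)).card * ∑ a, ‖c a * thetaK ζ a x j‖ₑ ^ (2 : ℝ) :=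
          enorm_finset_sum_sq_le _ _
      _ = 6 * ∑ a, ‖c a‖ₑ ^ (2 : ℝ) * ‖thetaK ζ a x j‖ₑ ^ (2 : ℝ) := by
          have hcard : (((Finset.univ : Finset (Fin 3 ⊕ Fin 3)).card : ℕ) : ℝ≥0∞) = 6 := by
            norm_num [Finset.card_univ, Fintype.card_sum, Fintype.card_fin]
          rw [hcard]
          congr 1
          exact Finset.sum_congr rfl fun a _ ↦ by rw [enorm_mul, ENNReal.mul_rpow_of_nonneg _ _ (by norm_num)]
  calc ∫⁻ x : E3, ‖∑ a, c a * thetaK ζ a x j‖ₑ ^ (2 : ℝ)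
      ≤ ∫⁻ x : E3, 6 * ∑ a, ‖c a‖ₑ ^ (2 : ℝ) * ‖thetaK ζ a x j‖ₑ ^ (2 : ℝ) := lintegral_mono hpt
    _ = 6 * ∑ a, ‖c a‖ₑ ^ (2 : ℝ) * ∫⁻ x : E3, ‖thetaK ζ a x j‖ₑ ^ (2 : ℝ) := by
        rw [lintegral_const_mul' _ _ (by norm_num), lintegral_finsetSum _ fun a _ ↦ hmeas a]
        congr 1
        refine Finset.sum_congr rfl fun a _ ↦ ?_
        rw [lintegral_const_mul' _ _ (ENNReal.rpow_ne_top_of_nonneg (by norm_num) enorm_ne_top)]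

/-- The `θ`-weights `∫ |(θ^a[η_k])_j|²` are finite. [folklore] -/
theorem lintegral_thetaK_annulusBump_sq_lt_top (k : ℕ) (a : Fin 3 ⊕ Fin 3) (j : Fin 3) :
    ∫⁻ x : E3, ‖thetaK (annulusBump k) a x j‖ₑ ^ (2 : ℝ) < ⊤ := by
  have hc : Continuous fun x ↦ thetaK (annulusBump k) a x j := continuous_thetaK (continuous_annulusBump k) a j
  have hm : MemLp (fun x ↦ thetaK (annulusBump k) a x j) 2 volume :=
    hc.memLp_of_hasCompactSupport (hasCompactSupport_thetaK (hasCompactSupport_annulusBump k) a j)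
  rw [lintegral_enorm_sq_eq_eLpNorm_sq]
  exact ENNReal.rpow_lt_top_of_nonneg (by norm_num) hm.eLpNorm_lt_top.ne

/-- **Uniform `L²` bound for the vector pieces**: there is `C < ∞` with `∫ |(F_k)_j|² ≤ C Σ_l ∫ |F_l|²` for all
continuous compactly supported `F` with `tsupp F ⊆ A₁`, all `k ≤ 15` and `j`. [cite: MaoOhTao2023, Lemma 2.2 (proof)] -/
theorem exists_l2Const_annulusPieceK :
    ∃ C : ℝ≥0∞, C < ⊤ ∧ ∀ F : Fin 3 → E3 → ℝ, (∀ j, Continuous (F j)) → (∀ j, HasCompactSupport (F j)) →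
      (∀ j, tsupport (F j) ⊆ {x : E3 | 1 < ‖x‖ ∧ ‖x‖ < 2}) → ∀ k ≤ 15, ∀ j : Fin 3,
        ∫⁻ x : E3, ‖chainPieceK annulusCutoff annulusBump 15 F k j x‖ₑ ^ (2 : ℝ) ≤
          C * ∑ l, ∫⁻ y : E3, ‖F l y‖ₑ ^ (2 : ℝ) := by
  set PK : ℝ≥0∞ := ∑ a' : Fin 3 ⊕ Fin 3, ∑ i, ∫⁻ y in closedBall (0 : E3) 2, ‖killingFn a' y i‖ₑ ^ (2 : ℝ) with hPK
  have hPKtop : PK < ⊤ := ENNReal.sum_lt_top.2 fun a _ ↦ ENNReal.sum_lt_top.2 fun i _ ↦ lintegral_killingFn_sq_lt_top 2 a i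
  set Th : ℝ≥0∞ := ∑ k ∈ Finset.range 17, ∑ a : Fin 3 ⊕ Fin 3, ∑ j : Fin 3,
    ∫⁻ x : E3, ‖thetaK (annulusBump k) a x j‖ₑ ^ (2 : ℝ) with hTh
  have hThtop : Th < ⊤ := ENNReal.sum_lt_top.2 fun k _ ↦ ENNReal.sum_lt_top.2 fun a _ ↦
    ENNReal.sum_lt_top.2 fun j _ ↦ lintegral_thetaK_annulusBump_sq_lt_top k a j
  have hThle : ∀ k ≤ 16, ∀ (a : Fin 3 ⊕ Fin 3) (j : Fin 3),
      ∫⁻ x : E3, ‖thetaK (annulusBump k) a x j‖ₑ ^ (2 : ℝ) ≤ Th := by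
    intro k hk a j
    calc ∫⁻ x : E3, ‖thetaK (annulusBump k) a x j‖ₑ ^ (2 : ℝ)
        ≤ ∑ j : Fin 3, ∫⁻ x : E3, ‖thetaK (annulusBump k) a x j‖ₑ ^ (2 : ℝ) :=
          Finset.single_le_sum (f := fun j ↦ ∫⁻ x : E3, ‖thetaK (annulusBump k) a x j‖ₑ ^ (2 : ℝ))
            (fun _ _ ↦ by positivity) (Finset.mem_univ j)
      _ ≤ ∑ a : Fin 3 ⊕ Fin 3, ∑ j : Fin 3, ∫⁻ x : E3, ‖thetaK (annulusBump k) a x j‖ₑ ^ (2 : ℝ) :=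
          Finset.single_le_sum (f := fun a : Fin 3 ⊕ Fin 3 ↦ ∑ j : Fin 3,
            ∫⁻ x : E3, ‖thetaK (annulusBump k) a x j‖ₑ ^ (2 : ℝ)) (fun _ _ ↦ by positivity) (Finset.mem_univ a)
      _ ≤ Th := Finset.single_le_sum (f := fun k ↦ ∑ a : Fin 3 ⊕ Fin 3, ∑ j : Fin 3,
            ∫⁻ x : E3, ‖thetaK (annulusBump k) a x j‖ₑ ^ (2 : ℝ)) (fun _ _ ↦ by positivity)
            (Finset.mem_range.2 (by omega))
  set W : ℝ≥0∞ := 6 * (6 * (16 * (16 * (9 * PK))) * Th) with hW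
  have hWtop : W < ⊤ := by
    refine ENNReal.mul_lt_top (by norm_num) (ENNReal.mul_lt_top (ENNReal.mul_lt_top (by norm_num)
      (ENNReal.mul_lt_top (by norm_num) (ENNReal.mul_lt_top (by norm_num)
        (ENNReal.mul_lt_top (by norm_num) hPKtop)))) hThtop)
  refine ⟨3 * (1 + W + W), ENNReal.mul_lt_top (by norm_num)
    (ENNReal.add_lt_top.2 ⟨ENNReal.add_lt_top.2 ⟨ENNReal.one_lt_top, hWtop⟩, hWtop⟩), ?_⟩
  intro F hF hFc hFA k hk j
  set SG : ℝ≥0∞ := ∑ l, ∫⁻ y : E3, ‖F l y‖ₑ ^ (2 : ℝ) with hSG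
  have hGle : (∫⁻ y : E3, ‖F j y‖ₑ ^ (2 : ℝ)) ≤ SG :=
    Finset.single_le_sum (f := fun l ↦ ∫⁻ y : E3, ‖F l y‖ₑ ^ (2 : ℝ)) (fun _ _ ↦ by positivity) (Finset.mem_univ j)
  have hM : ∀ k' a, ‖chainMomentK annulusCutoff 15 F k' a‖ₑ ^ (2 : ℝ) ≤ 16 * (16 * (9 * PK)) * SG := by
    intro k' a
    calc _ ≤ _ := enorm_chainMomentK_sq_le hF hFc hFA k' a
      _ = _ := by rw [hPK, hSG]; ring
  have hcorr : ∀ k' ≤ 16, ∫⁻ x : E3, ‖∑ a, chainMomentK annulusCutoff 15 F k' a * thetaK (annulusBump k') a x j‖ₑ ^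
      (2 : ℝ) ≤ W * SG := by
    intro k' hk'
    calc _ ≤ 6 * ∑ a, ‖chainMomentK annulusCutoff 15 F k' a‖ₑ ^ (2 : ℝ) *
          ∫⁻ x : E3, ‖thetaK (annulusBump k') a x j‖ₑ ^ (2 : ℝ) :=
          lintegral_sum_mul_thetaK_sq_le (continuous_annulusBump k') _ j
      _ ≤ 6 * ∑ _a : Fin 3 ⊕ Fin 3, (16 * (16 * (9 * PK)) * SG) * Th := by
          gcongr with a
          · exact hM k' a
          · exact hThle k' hk' a j
      _ = W * SG := by
          rw [Finset.sum_const, Finset.card_univ, Fintype.card_sum, Fintype.card_fin, nsmul_eq_mul, hW]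
          push_cast; ring
  set A : E3 → ℝ := fun x ↦ if k + 1 ≤ 15 then ∑ a, chainMomentK annulusCutoff 15 F (k + 1) a *
    thetaK (annulusBump (k + 1)) a x j else 0 with hA
  set B : E3 → ℝ := fun x ↦ if 1 ≤ k then ∑ a, chainMomentK annulusCutoff 15 F k a * thetaK (annulusBump k) a x j
    else 0 with hB
  have hpiece : ∀ x, chainPieceK annulusCutoff annulusBump 15 F k j x = F j x * annulusCutoff k x + A x - B x := by
    intro x; simp only [chainPieceK, hA, hB]
  have hpt : ∀ x, ‖chainPieceK annulusCutoff annulusBump 15 F k j x‖ₑ ^ (2 : ℝ) ≤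
      3 * (‖F j x‖ₑ ^ (2 : ℝ) + ‖A x‖ₑ ^ (2 : ℝ) + ‖B x‖ₑ ^ (2 : ℝ)) := by
    intro x
    rw [hpiece x]
    have h1 : ‖F j x * annulusCutoff k x‖ₑ ≤ ‖F j x‖ₑ := by
      rw [enorm_mul]
      have : ‖annulusCutoff k x‖ₑ ≤ 1 := by
        rw [Real.enorm_eq_ofReal_abs]; exact ENNReal.ofReal_le_one.2 (abs_annulusCutoff_le k x)
      calc ‖F j x‖ₑ * ‖annulusCutoff k x‖ₑ ≤ ‖F j x‖ₑ * 1 := by gcongr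
        _ = _ := mul_one _
    calc ‖F j x * annulusCutoff k x + A x - B x‖ₑ ^ (2 : ℝ) ≤ (‖F j x‖ₑ + ‖A x‖ₑ + ‖B x‖ₑ) ^ (2 : ℝ) := by
          refine ENNReal.rpow_le_rpow ?_ (by norm_num)
          calc ‖F j x * annulusCutoff k x + A x - B x‖ₑ ≤ ‖F j x * annulusCutoff k x + A x‖ₑ + ‖B x‖ₑ :=
                enorm_sub_le
            _ ≤ ‖F j x * annulusCutoff k x‖ₑ + ‖A x‖ₑ + ‖B x‖ₑ := by gcongr; exact enorm_add_le _ _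
            _ ≤ _ := by gcongr
      _ ≤ _ := enorm_add_three_sq_le _ _ _
  have hAm : Measurable fun x ↦ ‖A x‖ₑ ^ (2 : ℝ) := by
    refine (Measurable.enorm ?_).pow_const _
    simp only [hA]
    split_ifs
    · exact (continuous_finsetSum _ fun a _ ↦ continuous_const.mul
        (continuous_thetaK (continuous_annulusBump _) a j)).measurable
    · exact measurable_const
  have hfm : Measurable fun x ↦ ‖F j x‖ₑ ^ (2 : ℝ) := (hF j).measurable.enorm.pow_const _
  have hAint : ∫⁻ x, ‖A x‖ₑ ^ (2 : ℝ) ≤ W * SG := by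
    simp only [hA]
    split_ifs with h
    · exact hcorr (k + 1) (by omega)
    · simp
  have hBint : ∫⁻ x, ‖B x‖ₑ ^ (2 : ℝ) ≤ W * SG := by
    simp only [hB]
    split_ifs with h
    · exact hcorr k (by omega)
    · simp
  have hfAm : Measurable fun x ↦ ‖F j x‖ₑ ^ (2 : ℝ) + ‖A x‖ₑ ^ (2 : ℝ) := hfm.add hAm
  calc ∫⁻ x : E3, ‖chainPieceK annulusCutoff annulusBump 15 F k j x‖ₑ ^ (2 : ℝ)
      ≤ ∫⁻ x, 3 * (‖F j x‖ₑ ^ (2 : ℝ) + ‖A x‖ₑ ^ (2 : ℝ) + ‖B x‖ₑ ^ (2 : ℝ)) := lintegral_mono hpt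
    _ = 3 * ((∫⁻ x, ‖F j x‖ₑ ^ (2 : ℝ)) + (∫⁻ x, ‖A x‖ₑ ^ (2 : ℝ)) + ∫⁻ x, ‖B x‖ₑ ^ (2 : ℝ)) := by
        rw [lintegral_const_mul' _ _ (by norm_num), lintegral_add_left hfAm, lintegral_add_left hfm]
    _ ≤ 3 * (1 * SG + W * SG + W * SG) := by rw [one_mul]; gcongr
    _ = 3 * (1 + W + W) * SG := by ring

end PieceBoundsVec

/-! ### (T3) at the `L²` level: `L²` and `Ḣ¹` bounds of the annulus operator `T` -/

section OperatorBoundsVec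

/-- **Lemma 2.2, (T3) at the `L²` level**: there is `C < ∞` such that for every `F ∈ C²_c` with `tsupp F ⊆ A₁` and
all `i, j, l`: `∫ |(T F)^{ij}|², ∫ |∂_l (T F)^{ij}|² ≤ C Σ_k ∫ |F_k|²` — the linear operator `T` of the annulus maps
`L²(A₁)` boundedly into `H¹` (the paper's `‖T f‖_{H^{s'}} ≲ ‖f‖_{H^{s'-1}}` at `s' = 1`, on the dense class
`C²_c(A₁)`). [cite: MaoOhTao2023, Lemma 2.2 (T3)] -/
theorem exists_sobolevConst_annulusT :
    ∃ C : ℝ≥0∞, C < ⊤ ∧ ∀ F : Fin 3 → E3 → ℝ, (∀ j, ContDiff ℝ 2 (F j)) → (∀ j, HasCompactSupport (F j)) →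
      (∀ j, tsupport (F j) ⊆ {x : E3 | 1 < ‖x‖ ∧ ‖x‖ < 2}) → ∀ i j : Fin 3,
        (∫⁻ x : E3, ‖annulusT F i j x‖ₑ ^ (2 : ℝ) ≤ C * ∑ l, ∫⁻ y : E3, ‖F l y‖ₑ ^ (2 : ℝ)) ∧
        ∀ m : Fin 3, ∫⁻ x : E3, ‖pd m (annulusT F i j) x‖ₑ ^ (2 : ℝ) ≤ C * ∑ l, ∫⁻ y : E3, ‖F l y‖ₑ ^ (2 : ℝ) := by
  have h0 : ∀ k : ℕ, ∃ C : ℝ≥0∞, C < ⊤ ∧ ∀ (P : Fin 3 → E3 → ℝ), (∀ l, ContDiff ℝ 1 (P l)) →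
      (∀ l, HasCompactSupport (P l)) → (∀ l y, P l y ≠ 0 → ‖y‖ ≤ 2) → ∀ i j : Fin 3,
        ∫⁻ x : E3, ‖bogovskiiT (kernelBump k) P i j x‖ₑ ^ (2 : ℝ) ≤ C * ∑ l, ∫⁻ y : E3, ‖P l y‖ₑ ^ (2 : ℝ) := fun k ↦
    exists_l2Const_bogovskiiT (contDiff_kernelBump (n := 1) k) (kernelBump_eq_zero_of_lt k) (ρ := 2) (by norm_num)
  have h1 : ∀ k : ℕ, ∃ C : ℝ≥0∞, C < ⊤ ∧ ∀ (P : Fin 3 → E3 → ℝ), (∀ l, ContDiff ℝ 2 (P l)) →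
      (∀ l, HasCompactSupport (P l)) → (∀ l y, P l y ≠ 0 → ‖y‖ ≤ 2) → ∀ i j m : Fin 3,
        ∫⁻ x : E3, ‖pd m (bogovskiiT (kernelBump k) P i j) x‖ₑ ^ (2 : ℝ) ≤ C * ∑ l, ∫⁻ y : E3, ‖P l y‖ₑ ^ (2 : ℝ) :=
    fun k ↦ exists_h1Const_bogovskiiT (contDiff_kernelBump (n := 7) k) (kernelBump_eq_zero_of_lt k) 2
  choose C0 hC0 hB0 using h0
  choose C1 hC1 hB1 using h1
  obtain ⟨CP, hCP, hP⟩ := exists_l2Const_annulusPieceK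
  set K : ℝ≥0∞ := ∑ k ∈ Finset.range (15 + 1), (C0 k + C1 k) with hK
  have hKtop : K < ⊤ := ENNReal.sum_lt_top.2 fun k _ ↦ ENNReal.add_lt_top.2 ⟨hC0 k, hC1 k⟩
  have hKle : ∀ k ∈ Finset.range (15 + 1), C0 k ≤ K ∧ C1 k ≤ K := by
    intro k hk
    have h : C0 k + C1 k ≤ K := Finset.single_le_sum (f := fun k ↦ C0 k + C1 k) (fun _ _ ↦ by positivity) hk
    exact ⟨le_self_add.trans h, le_add_self.trans h⟩
  refine ⟨16 * (16 * (K * (3 * CP))), ENNReal.mul_lt_top (by norm_num) (ENNReal.mul_lt_top (by norm_num)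
    (ENNReal.mul_lt_top hKtop (ENNReal.mul_lt_top (by norm_num) hCP))), ?_⟩
  intro F hF hFc hFA i j
  have hFcn : ∀ l, Continuous (F l) := fun l ↦ (hF l).continuous
  set SG : ℝ≥0∞ := ∑ l, ∫⁻ y : E3, ‖F l y‖ₑ ^ (2 : ℝ) with hSG
  set P : ℕ → Fin 3 → E3 → ℝ := fun k l ↦ chainPieceK annulusCutoff annulusBump 15 F k l with hPdef
  have hP2 : ∀ k l, ContDiff ℝ 2 (P k l) := fun k l ↦ contDiff_annulusPieceK hF k l
  have hP1 : ∀ k l, ContDiff ℝ 1 (P k l) := fun k l ↦ (hP2 k l).of_le (by norm_cast)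
  have hPc : ∀ k l, HasCompactSupport (P k l) := fun k l ↦ hasCompactSupport_annulusPieceK hFc k l
  have hPρ : ∀ k ∈ Finset.range (15 + 1), ∀ l y, P k l y ≠ 0 → ‖y‖ ≤ 2 := fun k hk l y hy ↦
    norm_le_two_of_annulusPieceK_ne_zero hFA (by rw [Finset.mem_range] at hk; omega) l y hy
  have hPk : ∀ k ∈ Finset.range (15 + 1), ∑ l, ∫⁻ y, ‖P k l y‖ₑ ^ (2 : ℝ) ≤ 3 * CP * SG := by
    intro k hk
    have hk' : k ≤ 15 := by rw [Finset.mem_range] at hk; omega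
    calc ∑ l, ∫⁻ y, ‖P k l y‖ₑ ^ (2 : ℝ) ≤ ∑ _l : Fin 3, CP * SG :=
          Finset.sum_le_sum fun l _ ↦ hP F hFcn hFc hFA k hk' l
      _ = 3 * CP * SG := by rw [Finset.sum_const, Finset.card_univ, Fintype.card_fin, nsmul_eq_mul]; push_cast; ring
  set u : ℕ → E3 → ℝ := fun k ↦ bogovskiiT (kernelBump k) (P k) i j with hu
  have hu1 : ∀ k, ContDiff ℝ 1 (u k) := fun k ↦ contDiff_one_bogovskiiT (contDiff_kernelBump (n := 2) k)
    (kernelBump_eq_zero_of_lt k) (hP2 k) (hPc k) i j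
  have hu0 : ∀ k m, ContDiff ℝ 0 (pd m (u k)) := fun k m ↦ contDiff_pd (n := 0) (hu1 k) m
  have hS : annulusT F i j = fun x ↦ ∑ k ∈ Finset.range (15 + 1), u k x := rfl
  have hdS : ∀ m, pd m (annulusT F i j) = fun x ↦ ∑ k ∈ Finset.range (15 + 1), pd m (u k) x := by
    intro m; funext x
    rw [hS]
    exact pd_sum _ _ fun k _ ↦ ((hu1 k).differentiable one_ne_zero) x
  have hstep : ∀ (v : ℕ → E3 → ℝ), (∀ k, Measurable (v k)) →
      (∀ k ∈ Finset.range (15 + 1), ∫⁻ x, ‖v k x‖ₑ ^ (2 : ℝ) ≤ K * ∑ l, ∫⁻ y, ‖P k l y‖ₑ ^ (2 : ℝ)) →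
      ∫⁻ x : E3, ‖∑ k ∈ Finset.range (15 + 1), v k x‖ₑ ^ (2 : ℝ) ≤ 16 * (16 * (K * (3 * CP))) * SG := by
    intro v hvm hvb
    calc ∫⁻ x : E3, ‖∑ k ∈ Finset.range (15 + 1), v k x‖ₑ ^ (2 : ℝ)
        ≤ (Finset.range (15 + 1)).card * ∑ k ∈ Finset.range (15 + 1), ∫⁻ x, ‖v k x‖ₑ ^ (2 : ℝ) :=
          lintegral_enorm_sum_sq_le _ fun k _ ↦ hvm k
      _ ≤ (Finset.range (15 + 1)).card * ∑ k ∈ Finset.range (15 + 1), K * (3 * CP * SG) := by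
          gcongr with k hk
          exact (hvb k hk).trans (by gcongr; exact hPk k hk)
      _ = 16 * (16 * (K * (3 * CP))) * SG := by
          rw [Finset.sum_const, Finset.card_range, nsmul_eq_mul]; push_cast; ring
  refine ⟨?_, fun m ↦ ?_⟩
  · rw [hS]
    refine hstep u (fun k ↦ (hu1 k).continuous.measurable) fun k hk ↦ ?_
    exact (hB0 k (P k) (hP1 k) (hPc k) (hPρ k hk) i j).trans (by gcongr; exact (hKle k hk).1)
  · rw [hdS m]
    refine hstep (fun k ↦ pd m (u k)) (fun k ↦ (hu0 k m).continuous.measurable) fun k hk ↦ ?_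
    exact (hB1 k (P k) (hP2 k) (hPc k) (hPρ k hk) i j m).trans (by gcongr; exact (hKle k hk).2)

end OperatorBoundsVec

end MaoOhTao

end Literature.Geometry.Lorentzian
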